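import Mathlib
import Summits.ResolutionOfSingularities.ResolutionOfSingularities.Theorems.WeightedInvariantLocalWeightedDropPolyDescentNoChain
import Summits.ResolutionOfSingularities.ResolutionOfSingularities.Theorems.WeightedInvariantLocalWeightedDropPolyDescentMinimality
import Summits.ResolutionOfSingularities.ResolutionOfSingularities.Theorems.WeightedInvariantLocalWeightedDropPolyDescentPrepExists
import Summits.ResolutionOfSingularities.ResolutionOfSingularities.Theorems.WeightedInvariantLocalWeightedDropPolyDescentBridge
import Summits.ResolutionOfSingularities.ResolutionOfSingularities.Theorems.WeightedInvariantLocalWeightedDropWildMonicNewtonPointStep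
import Summits.ResolutionOfSingularities.ResolutionOfSingularities.Theorems.WeightedInvariantLocalWeightedDropWildPurePowerDescentTwo

/-!
# `WeightedInvariant.LocalWeightedDrop`: THE REGISTERED STUB S3ρ `stub_wildMonicSurfaceReductionWon` (skeleton v30, 09f812eb3be8b7d8) CLOSED BY NAME —
# the monic polyhedron descent (Cossart–Jannsen–Saito's surface algorithm for `y^d + Σ_{j<d} A_j y^j`, `e = 2`, `k = k̄`)

Crux item stmt-ResolutionOfSingularities-8899 `LocalWeightedDrop` (route `ResolutionOfSingularities/WeightedInvariant`).  [OURS · L1 W4.3 · chain w43 · LINE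
«monic polyhedron descent» (lead res-L1-w43-lead-1 gen 3; memo `L/res-L1-w43-lead-1/g3/S3RHO-CJS-MEMO.md`; line file `poly_descent_line_v1.lean` sha16
905148e143a15d9b, evidence on stmt-8899).  MODEL Cossart–Jannsen–Saito LNM 2270 Ch. 8/11–13; nothing here is a statement of any manuscript.]

The four pieces, all LANDED under `…Theorems.PolyDescent` with the line file's signatures VERBATIM:
* (ρ-P) `stub_polyPrep` — Hironaka's VERTEX PREPARATION (res-type-061 + res-L1-w43-stub-2: `…PolyDescentDissolveSegment`, `…PolyDescentDissolve`,
  `…PolyDescentPrepSeq`, `…PolyDescentPrepExists`);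
* (ρ-M) `stub_polyMinimality` — Hironaka's MINIMALITY of the well-prepared polygon (res-type-013: `…PolyDescentMinimalityForms`, `…PolyDescentMinimality`);
* (ρ-T) `stub_polyNoChain` — NO INFINITE Σ**_d-CHAIN of well-prepared positions (lead-1: `…PolyDescentCompare/ShearBeta/ShiftAlgebra/TailTools/Tail/NoChain`);
* (ρ-B) `stub_polyBridge` — the GAME BRIDGE (res-D-pv-058 AS stub-6 + res-type-061: `…PolyDescentAxisVertex`, `…BridgeExits`, `…BridgeSlices`, `…Bridge`).
COMPOSITION (this file): (ρ-P) + (ρ-M) + (ρ-T) + (ρ-B) ⇒ every well-prepared monic position with non-empty Newton set is won (dependent choice against the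
no-chain theorem, `won_of_pieces`) ⇒ every monic position is won (prepare first; the zero tuple is `y^d`) ⇒ S3ρ VERBATIM
(`wildMonicSurfaceReductionWon_of_polyDescent`; its hypotheses H<3, `p ∣ d` and the pure forms S3πM are idle) ⇒ `Theorems.stub_wildMonicSurfaceReductionWon`
by name.  With N4″ (p500522), S2sP/S2iM (p500771/p500912) and S3πM (p510457) this closes the whole N = 3 layer of the engine skeleton.
-/

set_option linter.dupNamespace false -- mandated namespace of this single-conjunct summit

noncomputable section

namespace Summit.ResolutionOfSingularities.ResolutionOfSingularities.Theorems

namespace PolyDescent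

open MvPowerSeries MonicDescent WildMonic Literature.AlgebraicGeometry.Resolution
  Literature.AlgebraicGeometry.Resolution.CobordantGame WildPurePower

/-! ## The composition -/

/-- The monic germ of the ZERO tuple is `y^d`, won in one move. -/
theorem won_monic_zero (k : Type) [Field k] (d : ℕ) :
    CobordantGame.Won k (2 + 1) ((X (Fin.last 2) : MvPowerSeries (Fin (2 + 1)) k) ^ d +
      ∑ j : Fin d, rename (Fin.succAboveEmb (Fin.last 2)) ((fun _ : Fin d => (0 : MvPowerSeries (Fin 2) k)) j) * X (Fin.last 2) ^ (j : ℕ)) := by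
  simp only [map_zero, zero_mul, Finset.sum_const_zero, add_zero]
  exact won_X_pow_last 2 d

/-- EVERY WELL-PREPARED POSITION WITH NON-EMPTY NEWTON SET IS WON, from (ρ-P), (ρ-M), (ρ-T), (ρ-B) (dependent choice on the bad labels). -/
theorem won_of_pieces (p : ℕ) (hp : p.Prime) (k : Type) [Field k] [CharP k p] [IsAlgClosed k] (d : ℕ) (h2d : 2 < d)
    (hord : ∀ g : MvPowerSeries (Fin 3) k, CobordantGame.IsSingular k g → g.order < d → CobordantGame.Won k 3 g)
    (haxis : ∀ g : MvPowerSeries (Fin 3) k, CobordantGame.IsSingular k g → g.order = d →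
      (∃ c : Fin 3 → k, c ≠ 0 ∧ ∀ v : Fin 3 → k,
        CobordantChart.initEval (fun _ : Fin 3 => 1) (v + c) d g = CobordantChart.initEval (fun _ : Fin 3 => 1) v d g) →
      (∀ c₁ c₂ : Fin 3 → k,
        (∀ v : Fin 3 → k, CobordantChart.initEval (fun _ : Fin 3 => 1) (v + c₁) d g = CobordantChart.initEval (fun _ : Fin 3 => 1) v d g) →
        (∀ v : Fin 3 → k, CobordantChart.initEval (fun _ : Fin 3 => 1) (v + c₂) d g = CobordantChart.initEval (fun _ : Fin 3 => 1) v d g) →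
        ∃ α β : k, (α ≠ 0 ∨ β ≠ 0) ∧ α • c₁ + β • c₂ = 0) →
      CobordantGame.Won k 3 g)
    (A : Fin d → MvPowerSeries (Fin 2) k) (hWP : WellPrepared d A) (hpos : IsPosT d A) (hne : (newtonSet A).Nonempty) :
    CobordantGame.Won k (2 + 1) ((X (Fin.last 2) : MvPowerSeries (Fin (2 + 1)) k) ^ d +
      ∑ j : Fin d, rename (Fin.succAboveEmb (Fin.last 2)) (A j) * X (Fin.last 2) ^ (j : ℕ)) := by
  classical
  have hd : 0 < d := by omega
  have hprep := stub_polyPrep k d hd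
  have hmin := stub_polyMinimality k d hd
  by_contra hnot
  let Bad : Set (Fin d → MvPowerSeries (Fin 2) k) := {B | WellPrepared d B ∧ IsPosT d B ∧ (newtonSet B).Nonempty ∧
    ¬ CobordantGame.Won k (2 + 1) ((X (Fin.last 2) : MvPowerSeries (Fin (2 + 1)) k) ^ d +
      ∑ j : Fin d, rename (Fin.succAboveEmb (Fin.last 2)) (B j) * X (Fin.last 2) ^ (j : ℕ))}
  have hnext : ∀ B ∈ Bad, ∃ B' ∈ succT d B, B' ∈ Bad := by
    rintro B ⟨hWPB, hposB, hneB, hnw⟩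
    by_contra hall
    push Not at hall
    exact hnw (stub_polyBridge p hp k d h2d hprep hord haxis B hWPB hposB hneB fun B' hB' hWP' hpos' hne' => by
      by_contra hn
      exact hall B' hB' ⟨hWP', hpos', hne', hn⟩)
  choose! nxt hnxt using hnext
  let seq : ℕ → (Fin d → MvPowerSeries (Fin 2) k) := fun m => Nat.rec A (fun _ B => nxt B) m
  have hseq : ∀ m, seq m ∈ Bad := by
    intro m
    induction m with
    | zero => exact ⟨hWP, hpos, hne, hnot⟩
    | succ m ih => exact (hnxt _ ih).2
  exact stub_polyNoChain k d hd hprep hmin ⟨seq, fun m => ⟨(hseq m).1, (hseq m).2.1, (hseq m).2.2.1, (hnxt _ (hseq m)).1⟩⟩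

/-- S3ρ FROM THE LINE: the registered stub `stub_wildMonicSurfaceReductionWon` of skeleton v30 VERBATIM.  Prepare the
position ((ρ-P), a free re-centring `WildMonic.won_monic_recentre_iff`); an empty Newton set means the zero tuple (`y^d`, won in one move); otherwise
`won_of_pieces`.  The hypotheses H<3, `p ∣ d` and the pure forms are not used. -/
theorem wildMonicSurfaceReductionWon_of_polyDescent : ∀ (p : ℕ), p.Prime → ∀ (k : Type) [Field k] [CharP k p] [IsAlgClosed k],
      (∀ m : ℕ, m < 3 → ∀ g : MvPowerSeries (Fin m) k,
        CobordantGame.IsSingular k g → CobordantGame.Won k m g) →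
      ∀ (d : ℕ), p ∣ d → 2 < d →
      (∀ g : MvPowerSeries (Fin 3) k, CobordantGame.IsSingular k g → g.order < d →
        CobordantGame.Won k 3 g) →
      (∀ g : MvPowerSeries (Fin 3) k, CobordantGame.IsSingular k g → g.order = d →
        (∃ c : Fin 3 → k, c ≠ 0 ∧ ∀ v : Fin 3 → k,
          CobordantChart.initEval (fun _ : Fin 3 => 1) (v + c) d g =
            CobordantChart.initEval (fun _ : Fin 3 => 1) v d g) →
        (∀ c₁ c₂ : Fin 3 → k,
          (∀ v : Fin 3 → k, CobordantChart.initEval (fun _ : Fin 3 => 1) (v + c₁) d g =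
            CobordantChart.initEval (fun _ : Fin 3 => 1) v d g) →
          (∀ v : Fin 3 → k, CobordantChart.initEval (fun _ : Fin 3 => 1) (v + c₂) d g =
            CobordantChart.initEval (fun _ : Fin 3 => 1) v d g) →
          ∃ α β : k, (α ≠ 0 ∨ β ≠ 0) ∧ α • c₁ + β • c₂ = 0) →
        CobordantGame.Won k 3 g) →
      ((∃ e : ℕ, d = p ^ e) → ∀ (A₀ : MvPowerSeries (Fin 2) k), (d : ℕ∞) < A₀.order →
        CobordantGame.Won k 3 (MvPowerSeries.X (Fin.last 2) ^ d +
          MvPowerSeries.rename (Fin.succAboveEmb (Fin.last 2)) A₀)) →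
      ∀ A : Fin d → MvPowerSeries (Fin 2) k, (∀ j : Fin d, ((d - (j : ℕ) : ℕ) : ℕ∞) < (A j).order) →
        CobordantGame.Won k 3 (MvPowerSeries.X (Fin.last 2) ^ d +
          ∑ j : Fin d, MvPowerSeries.rename (Fin.succAboveEmb (Fin.last 2)) (A j) * MvPowerSeries.X (Fin.last 2) ^ (j : ℕ)) := by
  intro p hp k _ _ _ _ d _ h2d hord haxis _ A hA
  classical
  have hd : 0 < d := by omega
  obtain ⟨ψ, hψ0, hposB, hWPB, -⟩ := stub_polyPrep k d hd A hA
  show CobordantGame.Won k (2 + 1) ((X (Fin.last 2) : MvPowerSeries (Fin (2 + 1)) k) ^ d +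
    ∑ j : Fin d, rename (Fin.succAboveEmb (Fin.last 2)) (A j) * X (Fin.last 2) ^ (j : ℕ))
  rw [← won_monic_recentre_iff ψ hψ0 A]
  by_cases hne : (newtonSet (shift d A ψ)).Nonempty
  · exact won_of_pieces p hp k d h2d hord haxis _ hWPB hposB hne
  · rw [Set.not_nonempty_iff_eq_empty, newtonSet_eq_empty_iff] at hne
    have h0 : shift d A ψ = fun _ => 0 := funext hne
    rw [h0]
    exact won_monic_zero k d

end PolyDescent

open Literature.AlgebraicGeometry.Resolution in
/-- THE REGISTERED STUB S3ρ `stub_wildMonicSurfaceReductionWon` OF SKELETON v30 (09f812eb3be8b7d8), BY NAME AND VERBATIM, from the line «monic polyhedron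
descent» (`PolyDescent.wildMonicSurfaceReductionWon_of_polyDescent`). -/
theorem stub_wildMonicSurfaceReductionWon : ∀ (p : ℕ), p.Prime → ∀ (k : Type) [Field k] [CharP k p] [IsAlgClosed k],
      (∀ m : ℕ, m < 3 → ∀ g : MvPowerSeries (Fin m) k,
        CobordantGame.IsSingular k g → CobordantGame.Won k m g) →
      ∀ (d : ℕ), p ∣ d → 2 < d →
      (∀ g : MvPowerSeries (Fin 3) k, CobordantGame.IsSingular k g → g.order < d →
        CobordantGame.Won k 3 g) →
      (∀ g : MvPowerSeries (Fin 3) k, CobordantGame.IsSingular k g → g.order = d →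
        (∃ c : Fin 3 → k, c ≠ 0 ∧ ∀ v : Fin 3 → k,
          CobordantChart.initEval (fun _ : Fin 3 => 1) (v + c) d g =
            CobordantChart.initEval (fun _ : Fin 3 => 1) v d g) →
        (∀ c₁ c₂ : Fin 3 → k,
          (∀ v : Fin 3 → k, CobordantChart.initEval (fun _ : Fin 3 => 1) (v + c₁) d g =
            CobordantChart.initEval (fun _ : Fin 3 => 1) v d g) →
          (∀ v : Fin 3 → k, CobordantChart.initEval (fun _ : Fin 3 => 1) (v + c₂) d g =
            CobordantChart.initEval (fun _ : Fin 3 => 1) v d g) →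
          ∃ α β : k, (α ≠ 0 ∨ β ≠ 0) ∧ α • c₁ + β • c₂ = 0) →
        CobordantGame.Won k 3 g) →
      ((∃ e : ℕ, d = p ^ e) → ∀ (A₀ : MvPowerSeries (Fin 2) k), (d : ℕ∞) < A₀.order →
        CobordantGame.Won k 3 (MvPowerSeries.X (Fin.last 2) ^ d +
          MvPowerSeries.rename (Fin.succAboveEmb (Fin.last 2)) A₀)) →
      ∀ A : Fin d → MvPowerSeries (Fin 2) k, (∀ j : Fin d, ((d - (j : ℕ) : ℕ) : ℕ∞) < (A j).order) →
        CobordantGame.Won k 3 (MvPowerSeries.X (Fin.last 2) ^ d +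
          ∑ j : Fin d, MvPowerSeries.rename (Fin.succAboveEmb (Fin.last 2)) (A j) * MvPowerSeries.X (Fin.last 2) ^ (j : ℕ)) :=
  PolyDescent.wildMonicSurfaceReductionWon_of_polyDescent


end Summit.ResolutionOfSingularities.ResolutionOfSingularities.Theorems

end
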